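import Mathlib.Probability.Moments.Variance
import Mathlib.Algebra.Order.BigOperators.Ring.Finset
import HarnessLib

/-!
# Inverse-variance weighting of uncorrelated unbiased estimates — the VEGAS cumulative estimate and its χ²

Topic `Probability/Moments`. VEGAS-type Monte Carlo integrators return a series of estimates
`I_1, …, I_n` of one integral, each with an error `σ_j`, and combine them as
[cite: Lepage2021, §2.5]

  `Ī = (Σ_j I_j/σ_j²) / (Σ_j 1/σ_j²)`,  `σ_Ī = (Σ_j 1/σ_j²)^{-1/2}`,  `χ² = Σ_j (I_j - Ī)²/σ_j²`,

"We expect `χ²` to be of order the number of iterations (less one) when the `I_j` are approximately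
Gaussian, and the estimates of the uncertainties `σ_j` are reliable" (loc. cit.). This file proves
the replicate accounting behind these three formulas for DETERMINISTIC weights and TRUE variances —
which is exactly the idealisation whose failure Lepage names next: "the weighted sum `Ī` only becomes
unbiased when `N_ev` is sufficiently large … The leading non-Gaussian effect is the correlation
between fluctuations in `I_j` and `σ_j²`. It introduces a bias in the weighted average" (§2.5).

For square-integrable real random variables `X : Fin n → Ω → ℝ` on a probability space and
deterministic weights `w : Fin n → ℝ`:

* `integral_weightedMean` — a common mean `μ₀` and `Σ w = 1` give `E[Σ w_j X_j] = μ₀` (ANY such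
  weights: unbiasedness needs neither the variances nor independence);
* `variance_weightedMean` — pairwise `cov = 0` gives `Var[Σ w_j X_j] = Σ w_j² Var X_j`;
* `inv_sum_inv_le_sum_sq_mul` — for `σ_j² > 0` and `Σ w = 1`, `(Σ 1/σ_j²)⁻¹ ≤ Σ w_j² σ_j²`
  (Sedrakyan/Cauchy–Schwarz), with equality at the inverse-variance weights
  (`sum_sq_invVarWeight_mul`): the inverse-variance combination is the minimum-variance unbiased
  linear combination, and its variance is Lepage's `σ_Ī² = (Σ 1/σ_j²)⁻¹`
  (`variance_weightedMean_invVarWeight`);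
* `integral_chiSq` — with a common mean, pairwise `cov = 0` and `Var X_j = σ_j²`, the statistic
  `χ² = Σ_j (X_j - Ī)²/σ_j²` has expectation EXACTLY `n - 1`, with no Gaussian hypothesis
  (Gaussianity is what makes `χ²` chi-square DISTRIBUTED; its mean is distribution-free).

Not proved, deliberately: nothing about ESTIMATED variances `σ̂_j²` (random weights correlated with
the `X_j` — the source of the VEGAS bias above), nothing distributional (no chi-square law, no
coverage of `Ī ± σ_Ī`). Users: the engines' `certquad.errbars.vegas_stats` / `combine_replicas`
compute `Ī`, `σ_Ī`, `χ²/dof` by these formulas; the theorems say what those numbers mean under the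
idealisation and nothing more.

References: G. P. Lepage, *Adaptive multidimensional integration: VEGAS enhanced*, J. Comput. Phys.
439 (2021) 110386, §2.5 "Combining and Comparing Iterations" (held text arXiv:2009.05112, chunk 6
lines 30–42 and chunk 7 lines 1–3) [Lepage2021] — the anchored source. The statistics are classical:
J. M. Lachin, *Biostatistical Methods*, Wiley 2000, §4.3.5 "Minimum Variance Linear Estimators"
("weighting inversely proportional to the variances (Meier, 1953) … provides an adjusted estimator that
is a minimum variance linear estimator"; "in practice, the estimate is computed using estimated
weights", held text pp. 111–112) [Lachin2000]; the `n - 1` is the expectation of Cochran's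
homogeneity statistic under a common mean.
-/

noncomputable section

open MeasureTheory ProbabilityTheory Finset
open scoped ENNReal

namespace Literature.Probability.Moments

variable {Ω : Type*} {n : ℕ}

/-- The weighted combination `Σ_j w_j X_j` of `n` estimates with deterministic weights `w`.
[cite: Lepage2021, §2.5] -/
def weightedMean (w : Fin n → ℝ) (X : Fin n → Ω → ℝ) : Ω → ℝ := fun ω ↦ ∑ j, w j * X j ω

/-- The inverse-variance weights `w_j = (1/σ_j²) / Σ_k (1/σ_k²)` (here `σ2 j` stands for `σ_j²`).
[cite: Lepage2021, §2.5] -/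
def invVarWeight (σ2 : Fin n → ℝ) (j : Fin n) : ℝ := (σ2 j)⁻¹ / ∑ k, (σ2 k)⁻¹

/-- The `χ²` statistic of the iterations against their inverse-variance combination,
`χ² = Σ_j (X_j - Ī)² / σ_j²`. [cite: Lepage2021, §2.5] -/
def chiSq (σ2 : Fin n → ℝ) (X : Fin n → Ω → ℝ) : Ω → ℝ :=
  fun ω ↦ ∑ j, (X j ω - weightedMean (invVarWeight σ2) X ω) ^ 2 / σ2 j

variable {σ2 : Fin n → ℝ}

/-! ### The weights (pure algebra) -/

/-- A nonempty sum of inverses of positive reals is positive. [folklore] -/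
private theorem sum_inv_pos (hσ : ∀ j, 0 < σ2 j) (hn : n ≠ 0) : 0 < ∑ k, (σ2 k)⁻¹ :=
  haveI : Nonempty (Fin n) := ⟨⟨0, Nat.pos_of_ne_zero hn⟩⟩
  Finset.sum_pos (fun k _ ↦ inv_pos.mpr (hσ k)) Finset.univ_nonempty

/-- The inverse-variance weights sum to one. [cite: Lepage2021, §2.5] -/
theorem sum_invVarWeight (hσ : ∀ j, 0 < σ2 j) (hn : n ≠ 0) : ∑ j, invVarWeight σ2 j = 1 := by
  simp only [invVarWeight, ← Finset.sum_div]
  exact div_self (sum_inv_pos hσ hn).ne'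

/-- At the inverse-variance weights, `Σ_j w_j² σ_j² = (Σ_k 1/σ_k²)⁻¹` — Lepage's `σ_Ī²`.
[cite: Lepage2021, §2.5] -/
theorem sum_sq_invVarWeight_mul (hσ : ∀ j, 0 < σ2 j) (hn : n ≠ 0) :
    ∑ j, invVarWeight σ2 j ^ 2 * σ2 j = (∑ k, (σ2 k)⁻¹)⁻¹ := by
  have hS := (sum_inv_pos hσ hn).ne'
  have h : ∀ j, invVarWeight σ2 j ^ 2 * σ2 j = (σ2 j)⁻¹ / (∑ k, (σ2 k)⁻¹) ^ 2 := by
    intro j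
    have hj := (hσ j).ne'
    simp only [invVarWeight]
    field_simp
  simp only [h, ← Finset.sum_div]
  field_simp

/-- **Minimum variance** (Sedrakyan's form of Cauchy–Schwarz): for any weights with `Σ w = 1` and
positive variances, `(Σ_k 1/σ_k²)⁻¹ ≤ Σ_j w_j² σ_j²`; by `sum_sq_invVarWeight_mul` the bound is attained
at the inverse-variance weights. [cite: Lepage2021, §2.5] ("The cumulative estimate is usually
superior to the estimates from separate iterations.") -/
theorem inv_sum_inv_le_sum_sq_mul (hσ : ∀ j, 0 < σ2 j) (w : Fin n → ℝ) (hw : ∑ j, w j = 1) :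
    (∑ k, (σ2 k)⁻¹)⁻¹ ≤ ∑ j, w j ^ 2 * σ2 j := by
  have h := Finset.sq_sum_div_le_sum_sq_div Finset.univ w (g := fun j ↦ (σ2 j)⁻¹)
    (fun j _ ↦ inv_pos.mpr (hσ j))
  simpa only [hw, one_pow, div_inv_eq_mul, one_div] using h

/-! ### The estimates -/

/-- `weightedMean w X` is the function `Σ_j w_j • X_j` (bookkeeping). [folklore] -/
private theorem weightedMean_eq_sum_smul (w : Fin n → ℝ) (X : Fin n → Ω → ℝ) :
    weightedMean w X = ∑ j, w j • X j := by
  ext ω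
  simp [weightedMean, Finset.sum_apply, smul_eq_mul]

variable [MeasurableSpace Ω] {μ : Measure Ω} {X : Fin n → Ω → ℝ}

/-- A weighted combination of square-integrable functions is square-integrable. [folklore] -/
private theorem memLp_weightedMean (w : Fin n → ℝ) (hX : ∀ j, MemLp (X j) 2 μ) :
    MemLp (weightedMean w X) 2 μ := by
  rw [weightedMean_eq_sum_smul]
  exact memLp_finsetSum' _ fun j _ ↦ (hX j).const_smul (w j)

/-- **Unbiasedness for any normalised deterministic weights**: a common mean `μ₀` and `Σ w = 1`
give `E[Σ_j w_j X_j] = μ₀`. [cite: Lepage2021, §2.5] (the weights need not be the inverse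
variances, and no second moment is used) -/
theorem integral_weightedMean (w : Fin n → ℝ) (hX : ∀ j, Integrable (X j) μ) {μ₀ : ℝ}
    (hmean : ∀ j, μ[X j] = μ₀) (hw : ∑ j, w j = 1) : μ[weightedMean w X] = μ₀ := by
  change ∫ ω, ∑ j, w j * X j ω ∂μ = μ₀
  rw [integral_finsetSum _ fun j _ ↦ (hX j).const_mul (w j)]
  simp only [integral_const_mul, hmean, ← Finset.sum_mul, hw, one_mul]

/-- Bienaymé for pairwise uncorrelated summands (local copy; from `ProbabilityTheory.variance_sum`).
[folklore] -/
private theorem variance_sum_of_cov_eq_zero [IsProbabilityMeasure μ] {Y : Fin n → Ω → ℝ}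
    (hY : ∀ j, MemLp (Y j) 2 μ) (hcov : Pairwise fun i j ↦ cov[Y i, Y j; μ] = 0) :
    Var[∑ j, Y j; μ] = ∑ j, Var[Y j; μ] := by
  rw [variance_sum hY]
  refine Finset.sum_congr rfl fun i _ ↦ ?_
  rw [Finset.sum_eq_single i (fun j _ hji ↦ hcov hji.symm) (by simp),
    covariance_self (hY i).aemeasurable]

/-- **Variance of a weighted combination** of pairwise uncorrelated square-integrable estimates:
`Var[Σ_j w_j X_j] = Σ_j w_j² Var X_j`. [cite: Lepage2021, §2.5] -/
theorem variance_weightedMean [IsProbabilityMeasure μ] (w : Fin n → ℝ) (hX : ∀ j, MemLp (X j) 2 μ)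
    (hcov : Pairwise fun i j ↦ cov[X i, X j; μ] = 0) :
    Var[weightedMean w X; μ] = ∑ j, w j ^ 2 * Var[X j; μ] := by
  rw [weightedMean_eq_sum_smul,
    variance_sum_of_cov_eq_zero (fun j ↦ (hX j).const_smul (w j)) fun i j hij ↦ by
      dsimp only
      rw [covariance_smul_left, covariance_smul_right, hcov hij, mul_zero, mul_zero]]
  simp only [variance_smul]

/-- **Lepage's `σ_Ī²`**: with true variances `Var X_j = σ_j² > 0` and pairwise `cov = 0`, the
inverse-variance combination has variance `(Σ_k 1/σ_k²)⁻¹`. [cite: Lepage2021, §2.5] -/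
theorem variance_weightedMean_invVarWeight [IsProbabilityMeasure μ] (hX : ∀ j, MemLp (X j) 2 μ)
    (hcov : Pairwise fun i j ↦ cov[X i, X j; μ] = 0) (hvar : ∀ j, Var[X j; μ] = σ2 j)
    (hσ : ∀ j, 0 < σ2 j) (hn : n ≠ 0) :
    Var[weightedMean (invVarWeight σ2) X; μ] = (∑ k, (σ2 k)⁻¹)⁻¹ := by
  rw [variance_weightedMean _ hX hcov]
  simp only [hvar]
  exact sum_sq_invVarWeight_mul hσ hn

/-- The inverse-variance combination has the least variance among all normalised deterministic
weightings of the same uncorrelated estimates. [cite: Lepage2021, §2.5] -/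
theorem variance_weightedMean_invVarWeight_le [IsProbabilityMeasure μ] (hX : ∀ j, MemLp (X j) 2 μ)
    (hcov : Pairwise fun i j ↦ cov[X i, X j; μ] = 0) (hvar : ∀ j, Var[X j; μ] = σ2 j)
    (hσ : ∀ j, 0 < σ2 j) (hn : n ≠ 0) (w : Fin n → ℝ) (hw : ∑ j, w j = 1) :
    Var[weightedMean (invVarWeight σ2) X; μ] ≤ Var[weightedMean w X; μ] := by
  rw [variance_weightedMean_invVarWeight hX hcov hvar hσ hn, variance_weightedMean _ hX hcov]
  simp only [hvar]
  exact inv_sum_inv_le_sum_sq_mul hσ w hw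

/-- The covariance of one estimate with the inverse-variance combination is the same for every `j`:
`cov(X_j, Ī) = w_j σ_j² = (Σ_k 1/σ_k²)⁻¹`. [cite: Lepage2021, §2.5] -/
theorem covariance_weightedMean_invVarWeight [IsProbabilityMeasure μ] (hX : ∀ j, MemLp (X j) 2 μ)
    (hcov : Pairwise fun i j ↦ cov[X i, X j; μ] = 0) (hvar : ∀ j, Var[X j; μ] = σ2 j)
    (hσ : ∀ j, 0 < σ2 j) (j : Fin n) :
    cov[X j, weightedMean (invVarWeight σ2) X; μ] = (∑ k, (σ2 k)⁻¹)⁻¹ := by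
  rw [weightedMean_eq_sum_smul, covariance_sum_right (fun k ↦ (hX k).const_smul _) (hX j),
    Finset.sum_eq_single j (fun k _ hkj ↦ by rw [covariance_smul_right, hcov hkj.symm, mul_zero])
      (by simp),
    covariance_smul_right, covariance_self (hX j).aemeasurable, hvar, invVarWeight,
    div_mul_eq_mul_div, inv_mul_cancel₀ (hσ j).ne', one_div]

/-- **`E[χ²] = n - 1` exactly**, for uncorrelated estimates with a common mean and TRUE variances
`σ_j²`, inverse-variance weights — no Gaussian hypothesis. [cite: Lepage2021, §2.5] ("We expect `χ²`
to be of order the number of iterations (less one)"; there under approximate Gaussianity, which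
governs the law of `χ²`, not its mean.) Proof: `E[(X_j - Ī)²] = Var(X_j - Ī) = σ_j² - 2 cov(X_j, Ī)
+ Var Ī = σ_j² - (Σ 1/σ²)⁻¹`, then sum `(σ_j² - S⁻¹)/σ_j²` over `j`. -/
theorem integral_chiSq [IsProbabilityMeasure μ] (hX : ∀ j, MemLp (X j) 2 μ)
    (hcov : Pairwise fun i j ↦ cov[X i, X j; μ] = 0) {μ₀ : ℝ} (hmean : ∀ j, μ[X j] = μ₀)
    (hvar : ∀ j, Var[X j; μ] = σ2 j) (hσ : ∀ j, 0 < σ2 j) (hn : n ≠ 0) :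
    μ[chiSq σ2 X] = (n : ℝ) - 1 := by
  set I := weightedMean (invVarWeight σ2) X with hI_def
  set S := ∑ k, (σ2 k)⁻¹ with hS_def
  have hS : S ≠ 0 := (sum_inv_pos hσ hn).ne'
  have hI : MemLp I 2 μ := memLp_weightedMean _ hX
  have hImean : μ[I] = μ₀ :=
    integral_weightedMean _ (fun j ↦ (hX j).integrable one_le_two) hmean (sum_invVarWeight hσ hn)
  -- second moment of each deviation
  have hdev : ∀ j, ∫ ω, (X j ω - I ω) ^ 2 ∂μ = σ2 j - S⁻¹ := by
    intro j
    have hD : MemLp (X j - I) 2 μ := (hX j).sub hI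
    have h0 : μ[X j - I] = 0 := by
      rw [integral_sub' ((hX j).integrable one_le_two) (hI.integrable one_le_two), hmean j, hImean,
        sub_self]
    have hv := variance_eq_sub hD
    rw [h0, variance_sub (hX j) hI, hvar j, covariance_weightedMean_invVarWeight hX hcov hvar hσ j,
      variance_weightedMean_invVarWeight hX hcov hvar hσ hn] at hv
    have : μ[(X j - I) ^ 2] = ∫ ω, (X j ω - I ω) ^ 2 ∂μ := by simp only [Pi.pow_apply, Pi.sub_apply]
    rw [← this]
    linarith
  -- sum them
  have hint : ∀ j, Integrable (fun ω ↦ (X j ω - I ω) ^ 2 / σ2 j) μ := fun j ↦ by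
    have := ((hX j).sub hI).integrable_sq
    simpa only [Pi.sub_apply] using this.div_const (σ2 j)
  change ∫ ω, ∑ j, (X j ω - I ω) ^ 2 / σ2 j ∂μ = _
  rw [integral_finsetSum _ fun j _ ↦ hint j]
  simp only [integral_div, hdev]
  have h : ∀ j, (σ2 j - S⁻¹) / σ2 j = 1 - S⁻¹ * (σ2 j)⁻¹ := fun j ↦ by
    have := (hσ j).ne'
    field_simp
  simp only [h, Finset.sum_sub_distrib, Finset.sum_const, Finset.card_univ, Fintype.card_fin,
    nsmul_eq_mul, mul_one, ← Finset.mul_sum, ← hS_def, inv_mul_cancel₀ hS]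

end Literature.Probability.Moments
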